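import Literature.Analysis.FluidPDE.Tao2016AveragedNS.PseudoOrbitPersistence
import HarnessLib

/-!
# Pseudo-orbits may be taken globally continuous

Cell `pub-fluidc`, blueprint seat 1 (gen 13). HONEST FRAMING: low prior, high value-of-information
experiment on Tao's machine paradigm [Tao2016AveragedNS, §5.5]; NOT a claim that NS blows up.

A pseudo-orbit (`IsPseudoOrbit F δ R T Y`, CircuitShadowing.lean) is only continuous ON the window
`[0,T]`; outside it `Y` is arbitrary. Extending `Y` by constants outside the window (`Set.IccExtend`)
produces a GLOBALLY continuous pseudo-orbit with the same data, the same right derivatives on `[0,T)`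
and the same values on `[0,T]`. Consequently the cell's seed-scale question
`PseudoOrbitTransitionSeed q` (NegativeKickSharp.lean) needs to be proved only for globally continuous
pseudo-orbits (`pseudoOrbitTransitionSeed_of_continuous`). For the port of the seed-scale chain
(SeedScaleIgnition … SeedScaleFiring, written for two-sided derivatives) to pseudo-orbits this removes
every `ContinuousOn` side condition (clock integral by the fundamental theorem of calculus, hitting
times by the intermediate value theorem, end points by closure): only the one-sidedness of the
derivative remains, handled by `RightDeriv.*` (PseudoOrbitPersistence.lean).

* `IsPseudoOrbit.exists_continuous` — a continuous pseudo-orbit agreeing with `Y` on `[0,T]`;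
* `pseudoOrbitTransitionSeed_of_continuous` — WLOG `Y` continuous in `PseudoOrbitTransitionSeed q`.
-/

namespace Literature.Analysis.FluidPDE.Tao2016AveragedNS

open Set Filter
open scoped NNReal Topology

variable {m : ℕ}

/-- **Continuous modification of a pseudo-orbit.** A pseudo-orbit on `[0,T]` (`T ≥ 0`) agrees on
`[0,T]` with a GLOBALLY continuous pseudo-orbit of the same field, defect, ball and window (extend by
constants). [cite: HairerNorsettWanner1993, §I.10] -/
theorem IsPseudoOrbit.exists_continuous {F : (Fin m → ℝ) → (Fin m → ℝ)} {δ : ℝ} {R : ℝ≥0} {T : ℝ}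
    {Y : ℝ → Fin m → ℝ} (h : IsPseudoOrbit F δ R T Y) (hT : 0 ≤ T) :
    ∃ Z : ℝ → Fin m → ℝ, Continuous Z ∧ EqOn Z Y (Icc 0 T) ∧ IsPseudoOrbit F δ R T Z := by
  have hZc : Continuous (IccExtend hT ((Icc 0 T).restrict Y)) :=
    (continuousOn_iff_continuous_restrict.1 h.continuousOn).Icc_extend'
  have hEq : EqOn (IccExtend hT ((Icc 0 T).restrict Y)) Y (Icc 0 T) :=
    fun t ht => by rw [IccExtend_of_mem hT _ ht]; rfl
  refine ⟨IccExtend hT ((Icc 0 T).restrict Y), hZc, hEq, ?_, ?_, ?_⟩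
  · exact hZc.continuousOn
  · intro t ht
    obtain ⟨V, hV, hVF⟩ := h.defect t ht
    have htT : t ∈ Icc 0 T := ⟨ht.1, ht.2.le⟩
    refine ⟨V, ?_, by rw [hEq htT]; exact hVF⟩
    refine hV.congr_of_eventuallyEq ?_ (hEq htT)
    have hmem : Ici t ∩ Iio T ∈ 𝓝[Ici t] t := inter_mem_nhdsWithin (Ici t) (Iio_mem_nhds ht.2)
    filter_upwards [hmem] with u hu
    exact hEq ⟨ht.1.trans hu.1, hu.2.le⟩
  · intro t ht
    rw [hEq ⟨ht.1, ht.2.le⟩]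
    exact h.norm_le t ht

/-- **WLOG globally continuous.** To prove the cell's seed-scale question `PseudoOrbitTransitionSeed q`
it suffices to prove it for pseudo-orbits that are continuous on all of `ℝ` (the conclusion and the
datum condition only see `[0,T]`). [cite: Tao2016AveragedNS, Theorem 5.3] -/
theorem pseudoOrbitTransitionSeed_of_continuous {q : ℕ}
    (h : ∀ (K M ε δ δ₀ T : ℝ) (Y : ℝ → Fin 5 → ℝ),
      2 * 20 ^ 42 * (Nat.factorial 42 : ℝ) + 16 ≤ K → 3000 * Real.log K ≤ M → M ≤ K ^ 10 →
      0 < ε → ε ≤ Real.exp (-(10 * M)) / K ^ 100 → 2 ≤ T → 0 ≤ δ₀ → 0 ≤ δ →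
      Continuous Y → IsPseudoOrbit (delayCircuitWith K M ε) δ 2 T Y → ‖Y 0 - delayInit‖ ≤ δ₀ →
      δ₀ + δ * T ≤ ε ^ 2 * Real.exp (-M) / K ^ q →
      ∀ t ∈ Icc 2 T, |Y t 4 - 1| ≤ 1 / 4 ∧ ∀ i : Fin 5, i ≠ 4 → |Y t i| ≤ 1 / 4) :
    PseudoOrbitTransitionSeed q := by
  intro K M ε δ δ₀ T Y hK hML hMK hε hεle hT hδ₀ hδ hY h0 hb t ht
  obtain ⟨Z, hZc, hZY, hZ⟩ := hY.exists_continuous (by linarith)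
  have h0' : ‖Z 0 - delayInit‖ ≤ δ₀ := by rw [hZY ⟨le_rfl, by linarith⟩]; exact h0
  have key := h K M ε δ δ₀ T Z hK hML hMK hε hεle hT hδ₀ hδ hZc hZ h0' hb t ht
  have htT : t ∈ Icc 0 T := ⟨by linarith [ht.1], ht.2⟩
  rw [hZY htT] at key
  exact key

end Literature.Analysis.FluidPDE.Tao2016AveragedNS
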